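import Mathlib.Analysis.SpecialFunctions.Log.Basic
import Mathlib.Order.ConditionallyCompleteLattice.Basic
import Mathlib.Order.Interval.Finset.Nat
import HarnessLib

/-!
# Counting and parameter bookkeeping for Schneider's method at a cusp

Elementary lemmas used by the zero-lower-log-density theorem for integer points of a germ at a
cusp (`Literature.NumberTheory.Transcendental.SchneiderCuspGerm`):

* `natCard_le_and_eq_card_filter`: the counting function `#{N ≤ X : p N}` as a `Finset.card`;
  `card_filter_Iic_eq_add`: additivity over `[0, a] ∪ (a, b]`;
* `exists_lt_of_log_lt_card`: if `#{N ≤ X : p N} > ε log X` for all large `X` then `p` holds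
  beyond every bound;
* `exists_near_record_low`: a sequence bounded below by a positive constant has, beyond any
  `M`, an index `Y₀` with `r Y₀ < 2 r X` for all `X ≥ Y₀` (the "near-record-low from the
  right" used to fix the scale of the auxiliary function without knowing `liminf r`);
* `phase_one_neg`, `phase_two_neg`: the two real inequalities of the extrapolation (parameters
  `q = 8 s`, `s = e + d`, `D = q k`, `T = s D`, `m = D²/2`; see the module docstring of
  `SchneiderCuspGerm` for their origin).

## References

* [folklore] M. Waldschmidt, Pólya's theorem by Schneider's method, *Acta Math. Acad. Sci.
  Hungar.* 31 (1978) 21–25 (the parameter pattern); standard real analysis otherwise.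
-/

open Finset

namespace Literature.NumberTheory.Transcendental

/-- The counting function of a predicate on `ℕ` as a `Finset.card`:
`Nat.card {N | N ≤ X ∧ p N} = #((Iic X).filter p)`. [folklore] -/
theorem natCard_setOf_le_and_eq (p : ℕ → Prop) [DecidablePred p] (X : ℕ) :
    Nat.card {N : ℕ | N ≤ X ∧ p N} = ((Iic X).filter p).card := by
  have h : {N : ℕ | N ≤ X ∧ p N} = ↑((Iic X).filter p) := by
    ext N
    simp only [Set.mem_setOf_eq, coe_filter, mem_Iic]
  rw [h, Nat.card_coe_set_eq, Set.ncard_coe_finset]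

/-- Additivity of the counting function: for `a ≤ b`,
`#((Iic b).filter p) = #((Iic a).filter p) + #((Ioc a b).filter p)`. [folklore] -/
theorem card_filter_Iic_eq_add (p : ℕ → Prop) [DecidablePred p] {a b : ℕ} (hab : a ≤ b) :
    ((Iic b).filter p).card = ((Iic a).filter p).card + ((Ioc a b).filter p).card := by
  have hU : Iic b = Iic a ∪ Ioc a b := by
    ext N
    simp only [mem_Iic, mem_union, mem_Ioc]
    omega
  rw [hU, filter_union, card_union_of_disjoint]
  exact disjoint_filter_filter (disjoint_left.mpr fun N h1 h2 => by
    simp only [mem_Iic] at h1; simp only [mem_Ioc] at h2; omega)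

/-- Monotonicity of the counting function. [folklore] -/
theorem card_filter_Iic_mono (p : ℕ → Prop) [DecidablePred p] {a b : ℕ} (hab : a ≤ b) :
    ((Iic a).filter p).card ≤ ((Iic b).filter p).card := by
  rw [card_filter_Iic_eq_add p hab]
  exact Nat.le_add_right _ _

/-- The counting function is at most `X + 1`. [folklore] -/
theorem card_filter_Iic_le (p : ℕ → Prop) [DecidablePred p] (X : ℕ) :
    ((Iic X).filter p).card ≤ X + 1 :=
  (card_filter_le _ _).trans (by simp)

/-- **Unboundedness.** If `#{N ≤ X : p N} > ε log X` for all `X ≥ X₁` (`ε > 0`), then `p` holds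
at arbitrarily large arguments. [folklore] -/
theorem exists_lt_of_log_lt_card (p : ℕ → Prop) [DecidablePred p] {ε : ℝ} (hε : 0 < ε) {X₁ : ℕ}
    (h : ∀ X : ℕ, X₁ ≤ X → ε * Real.log X < ((Iic X).filter p).card) (B : ℕ) :
    ∃ K, B < K ∧ p K := by
  by_contra hcon
  push Not at hcon
  -- then the counting function is bounded by `B + 1`
  have hbound : ∀ X, ((Iic X).filter p).card ≤ B + 1 := by
    intro X
    calc ((Iic X).filter p).card ≤ (Iic B).card := by
          refine card_le_card fun N hN => ?_
          simp only [mem_filter, mem_Iic] at hN ⊢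
          by_contra hNB
          exact hcon N (by omega) hN.2
      _ = B + 1 := by simp
  -- choose `X` with `ε log X ≥ B + 1`
  set X : ℕ := max X₁ ⌈Real.exp ((B + 1) / ε)⌉₊ with hX
  have hX₁ : X₁ ≤ X := le_max_left _ _
  have hXc : ⌈Real.exp ((B + 1) / ε)⌉₊ ≤ X := le_max_right _ _
  have hXexp : Real.exp ((B + 1) / ε) ≤ X := (Nat.le_ceil _).trans (by exact_mod_cast hXc)
  have hXpos : (0 : ℝ) < X := (Real.exp_pos _).trans_le hXexp
  have hlog : (B + 1) / ε ≤ Real.log X := (Real.le_log_iff_exp_le hXpos).mpr hXexp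
  have h1 := h X hX₁
  have h2 : (((Iic X).filter p).card : ℝ) ≤ B + 1 := by exact_mod_cast hbound X
  have h3 : (B + 1 : ℝ) ≤ ε * Real.log X := by
    rw [div_le_iff₀ hε] at hlog
    linarith
  linarith

/-- **Near-record-low from the right.** If `r X ≥ ι₀ > 0` for all `X ≥ M`, there is `Y₀ ≥ M` with
`r Y₀ < 2 r X` for every `X ≥ Y₀` (take `r Y₀ < 2 inf_{X ≥ M} r X`). [folklore] -/
theorem exists_near_record_low (r : ℕ → ℝ) {ι₀ : ℝ} (hι₀ : 0 < ι₀) (M : ℕ)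
    (hr : ∀ X, M ≤ X → ι₀ ≤ r X) : ∃ Y₀, M ≤ Y₀ ∧ ∀ X, Y₀ ≤ X → r Y₀ < 2 * r X := by
  set S : Set ℝ := r '' {X | M ≤ X} with hS
  have hne : S.Nonempty := ⟨r M, ⟨M, Set.mem_setOf.mpr le_rfl, rfl⟩⟩
  have hlow : ∀ y ∈ S, ι₀ ≤ y := by
    rintro _ ⟨X, hX, rfl⟩
    exact hr X hX
  have hbdd : BddBelow S := ⟨ι₀, hlow⟩
  have hι : ι₀ ≤ sInf S := le_csInf hne hlow
  have hlt : sInf S < 2 * sInf S := by linarith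
  obtain ⟨_, ⟨Y₀, hY₀, rfl⟩, hY₀lt⟩ := exists_lt_of_csInf_lt hne hlt
  refine ⟨Y₀, hY₀, fun X hX => ?_⟩
  have hXS : sInf S ≤ r X := csInf_le hbdd ⟨X, le_trans hY₀ hX, rfl⟩
  linarith

/-- **Phase-one inequality** of the extrapolation (`s = e + d ≥ 1`, `k ≥ 1`, `D = 8 s k`,
`T = 8 s² k`, `m = 32 s² k²`, `λ ≥ 2 lρ + lC + 2`, `lC ≥ 0`, `lD ≤ D - 1`):
`T (k λ) + (4 lD + 2 D lC + k T λ) + m (lρ - λ) < 0`. [folklore] -/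
theorem phase_one_neg {s k lD lC lρ lam : ℝ} (hs : 1 ≤ s) (hk : 1 ≤ k)
    (hlD : lD ≤ 8 * s * k - 1) (hlC : 0 ≤ lC) (hlam : 2 * lρ + lC + 2 ≤ lam) :
    8 * s ^ 2 * k * (k * lam) + (4 * lD + 2 * (8 * s * k) * lC + k * (8 * s ^ 2 * k) * lam) +
      32 * s ^ 2 * k ^ 2 * (lρ - lam) < 0 := by
  have hsk : 1 ≤ s * k := by nlinarith
  have hsk2 : s * k ≤ s ^ 2 * k ^ 2 := by nlinarith
  have h1 : 16 * (s ^ 2 * k ^ 2) * lam ≥ 16 * (s ^ 2 * k ^ 2) * (2 * lρ + lC + 2) :=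
    mul_le_mul_of_nonneg_left hlam (by positivity)
  have h2 : 16 * (s * k) * lC ≤ 16 * (s ^ 2 * k ^ 2) * lC :=
    mul_le_mul_of_nonneg_right (by linarith) hlC
  nlinarith

/-- **Phase-two inequality** of the extrapolation (`s = e + d ≥ 1`, `k ≥ 16`, `D = 8 s k`,
`T = 8 s² k`, `n₀ ≥ 128 s² k`, `λ ≥ 2 lρ + lC + 2`, `lD ≤ D`, `k λ ≤ ℓ₁`, `ℓ ≤ ℓ₁ + 1`,
`Z ≥ n₀ ℓ₁ / (2 λ) - n₀`):
`T ℓ + (4 lD + 2 D lC + k T λ) + Z (lρ - λ) < 0`. [folklore] -/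
theorem phase_two_neg {s k n₀ lD lC lρ lam ℓ ℓ₁ Z : ℝ} (hs : 1 ≤ s) (hk : 16 ≤ k)
    (hn₀ : 128 * s ^ 2 * k ≤ n₀) (hlD : lD ≤ 8 * s * k) (hlC : 0 ≤ lC) (hlρ : 0 ≤ lρ)
    (hlam : 2 * lρ + lC + 2 ≤ lam) (hkℓ : k * lam ≤ ℓ₁) (hℓ : ℓ ≤ ℓ₁ + 1)
    (hZ : n₀ * ℓ₁ / (2 * lam) - n₀ ≤ Z) :
    8 * s ^ 2 * k * ℓ + (4 * lD + 2 * (8 * s * k) * lC + k * (8 * s ^ 2 * k) * lam) +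
      Z * (lρ - lam) < 0 := by
  have hlam0 : 0 < lam := by linarith
  have hk0 : 0 < k := by linarith
  have hn₀0 : 0 < n₀ := by nlinarith
  -- `Z₀ := n₀ ℓ₁/(2λ) - n₀ ≥ 0`
  have hℓ₁ : 2 * lam ≤ ℓ₁ := by nlinarith
  have hZ₀ : 0 ≤ n₀ * ℓ₁ / (2 * lam) - n₀ := by
    rw [sub_nonneg, le_div_iff₀ (by linarith)]
    nlinarith
  -- `Z (lρ - λ) ≤ Z₀ (lρ - λ) ≤ -Z₀ λ/2`
  have hneg : lρ - lam ≤ -(lam / 2) := by linarith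
  have hstep1 : Z * (lρ - lam) ≤ (n₀ * ℓ₁ / (2 * lam) - n₀) * (lρ - lam) :=
    mul_le_mul_of_nonpos_right hZ (by linarith)
  have hstep2 : (n₀ * ℓ₁ / (2 * lam) - n₀) * (lρ - lam) ≤
      (n₀ * ℓ₁ / (2 * lam) - n₀) * (-(lam / 2)) := mul_le_mul_of_nonneg_left hneg hZ₀
  have hstep3 : (n₀ * ℓ₁ / (2 * lam) - n₀) * (-(lam / 2)) = -(n₀ * ℓ₁ / 4) + n₀ * lam / 2 := by
    field_simp
    ring
  -- the positive terms against `n₀ ℓ₁ / 4`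
  have hT : 8 * s ^ 2 * k ≤ n₀ / 16 := by linarith
  have hℓ0 : 0 ≤ ℓ₁ := by nlinarith
  have hA : 8 * s ^ 2 * k * ℓ ≤ n₀ / 16 * ℓ₁ + n₀ / 16 := by
    have : 8 * s ^ 2 * k * ℓ ≤ 8 * s ^ 2 * k * (ℓ₁ + 1) :=
      mul_le_mul_of_nonneg_left hℓ (by positivity)
    nlinarith
  have hB : k * (8 * s ^ 2 * k) * lam ≤ n₀ / 16 * ℓ₁ := by
    have : k * (8 * s ^ 2 * k) * lam = 8 * s ^ 2 * k * (k * lam) := by ring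
    rw [this]
    calc 8 * s ^ 2 * k * (k * lam) ≤ 8 * s ^ 2 * k * ℓ₁ :=
          mul_le_mul_of_nonneg_left hkℓ (by positivity)
      _ ≤ n₀ / 16 * ℓ₁ := mul_le_mul_of_nonneg_right hT hℓ0
  have h16 : 16 * lam ≤ ℓ₁ := by nlinarith
  have hC : n₀ * lam / 2 ≤ n₀ / 32 * ℓ₁ := by
    nlinarith [mul_le_mul_of_nonneg_left h16 hn₀0.le]
  have hD1 : 4 * lD ≤ n₀ / 4 := by nlinarith
  have hD2 : 2 * (8 * s * k) * lC ≤ n₀ / 8 * lC := by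
    have : 8 * s * k ≤ n₀ / 16 := by nlinarith
    nlinarith
  -- margin: `(3/32) n₀ ℓ₁ ≥ (3/2) n₀ λ ≥ n₀ (3 + 3 lC/2)`
  have hM : n₀ * (3 + 3 * lC / 2) ≤ 3 / 32 * n₀ * ℓ₁ := by
    have h1 : n₀ * (3 + 3 * lC / 2) ≤ n₀ * (3 / 2 * lam) :=
      mul_le_mul_of_nonneg_left (by linarith) hn₀0.le
    nlinarith [mul_le_mul_of_nonneg_left h16 hn₀0.le]
  nlinarith

end Literature.NumberTheory.Transcendental
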